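import Summits.QuantumFields.QCD.Theses.FemtoStepScaling

/-!
# Route FemtoStepScaling — Assembly (item stmt-QuantumFields-11452)

The assembly of route `route-QuantumFields-FemtoStepScaling` (sub-problem `QCD` of the summit
`QuantumFields`) is pure logic over the route file:

`FiniteVolumeContinuumLimitR → BoxMixingDecayR → PhysicalFiniteSizeCriterionR →
InfiniteVolumePackageR → QCD`.

Fix `N_f ∈ {2, 3}`.  `FiniteVolumeContinuumLimitR` hands a regularisation `reg` with the
good-trajectory clauses (mass scaling, two-loop asymptotic scaling, `m_crit(k) > -1` eventually) and
the guarded, non-degenerate finite-volume UV clause; `BoxMixingDecayR`, fed the convergence clause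
and the time-separated N2 witnesses extracted from the UV clause, returns a mass offset `M₀` and, for
every mass tuple above `max M₀ 0` (so that `m_f > 0` is also at hand) and the universal `ε` of
`PhysicalFiniteSizeCriterionR`, a physical scale `ℓ > 0` with box mixing `≤ ε` eventually in the
cutoff; the criterion (fed asymptotic scaling, `m_crit > -1` eventually and `m_f > 0`) returns the
gluonic uniform lattice gap with `Δ = c / ℓ > 0`; `InfiniteVolumePackageR` converts
`(reg, UV clause, ∃ M₀' ∀ m > M₀' ∃ Δ > 0 gap)` with `M₀' = max M₀ 0` into `QCDOf N_f`; and `QCD` is by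
definition `QCDOf 2 ∧ QCDOf 3`.  This is literally the type of the route's kernel-checked deciding
theorem `Summit.QuantumFields.QCD.Theses.FemtoStepScaling.closes` (D-0027 §2.1), which this file
invokes; no analysis, no named facts; axioms ⊆ {propext, Classical.choice, Quot.sound}.

References: A. Jaffe, E. Witten, *Quantum Yang–Mills theory* (Clay problem description, 2000);
I. Montvay, G. Münster, *Quantum fields on a lattice* (CUP, 1994).
-/

namespace Summit.QuantumFields.QCD.Theorems

open Summit.QuantumFields.QCD.Theses.FemtoStepScaling

/-- **Assembly of route FemtoStepScaling** (item stmt-QuantumFields-11452):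
`FiniteVolumeContinuumLimitR → BoxMixingDecayR → PhysicalFiniteSizeCriterionR →
InfiniteVolumePackageR → QCD`.
Proof: the four hypotheses are exactly those of the route's deciding theorem `closes`, whose
conclusion is `QCD`; unfold and apply it (for `N_f = 2, 3`: UV limits give `reg`, box-mixing decay
gives the offset and a mixing scale `ℓ`, the finite-size criterion gives the gap `c / ℓ`, the
package gives `QCDOf N_f`). [folklore] -/
theorem femtoStepScalingAssembly_proof :
    Summit.QuantumFields.QCD.Theses.FemtoStepScaling.Assembly := by
  unfold Summit.QuantumFields.QCD.Theses.FemtoStepScaling.Assembly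
  intro h1 h2 h3 h4
  exact closes h1 h2 h3 h4

end Summit.QuantumFields.QCD.Theorems
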